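import Literature.Analysis.FluidPDE.NewtonPotentialGradientFarField
import Literature.Analysis.FluidPDE.BiotSavartIntegral
import Literature.Analysis.FluidPDE.PineauVicolEnstrophy
import Literature.Analysis.FluidPDE.HydrodynamicImpulse
import HarnessLib

/-!
# Far field of the Biot–Savart velocity of a vorticity with vanishing moments: `|u| ≲ (1 + |x|)⁻⁴`

Analysis/FluidPDE support file (theorems only; no definitions, no named facts). Lemarié-Rieusset
(2016), §4.10, expands the Biot–Savart velocity `u = K₃ ∗ ω` of a rapidly decaying vorticity
(`|ω| ≤ C(1 + |x|)^{-5-γ}`) at infinity,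

  `u = ∇G ∧ A + Σᵢ ∇∂ᵢG ∧ Bᵢ + Σᵢⱼ ∇∂ᵢ∂ⱼG ∧ Cᵢⱼ + o(|x|⁻⁴)`,
  `A = ∫ ω dy`,  `Bᵢ = −∫ yᵢ ω dy`,  `G = 1/(4π|x|)`                                    (4.37)

so that `A = 0 ⇒ u = O(|x|⁻³)`, and `u = o(|x|⁻⁴)` forces the dipole terms to vanish ((4.38)). This
file proves the corresponding BOUND for the tree's Biot–Savart law `biotSavart ω x = ∫ K(x − y) ω(y) dy`,
`K(z)h = (4π|z|³)⁻¹ h × z` (`Vorticity.lean`): if `ω ∈ L¹ ∩ L^∞` has finite second moment, quintic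
decay `‖y‖⁵‖ω(y)‖ ≤ C₅`, zero total vorticity `∫ ω = 0` and vanishing first moments
`∫ ωⱼ(y) y dy = 0` (`j = 0, 1, 2`; for a divergence-free `ω` these nine moments are the entries of an
antisymmetric matrix, i.e. the hydrodynamic impulse `½∫ y × ω`, Saffman (3.2.8)), then

  `(1 + ‖x‖)⁴ ‖biotSavart ω x‖ ≤ K (C₀ + ‖ω‖₁ + ∫‖y‖²‖ω‖ + C₅)`  for all `x`

(`exists_forall_one_add_norm_pow_four_mul_norm_biotSavart_le`). The components of `K(z)h` are the
gradient kernels of the Newtonian potential against the components of `h`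
(`biotSavartKernel_apply_zero/one/two`: `(K(z)h)₀ = ∂₂Γ(z)h₁ − ∂₁Γ(z)h₂`, …; Majda–Bertozzi
(2.92)–(2.94) `K₃ ∗ ω = −curl(Γ ∗ ω)`), so each component of `u` is a difference of two gradient
potentials `∫ ∂ᵢΓ(x − y) ωⱼ(y) dy`, to which the second-order far-field expansion of
`NewtonPotentialGradientFarField.lean` (`exists_forall_one_add_norm_pow_four_mul_abs_integral_le`)
applies. The last section turns the hypothesis «vanishing first moments» into Saffman's «zero
hydrodynamic impulse `½∫ y × ω dy = 0`» for a `C¹` divergence-free vorticity with finite first moment: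
the moment matrix `Mᵢⱼ = ∫ yᵢ ωⱼ` is antisymmetric (`integral_coord_mul_apply_add_eq_zero`, the
divergence theorem for `(yᵢyⱼ) ω`), so `I = 0` forces `M = 0`
(`integral_apply_smul_self_eq_zero_of_impulse_eq_zero`), whence the impulse form
`exists_forall_one_add_norm_pow_four_mul_norm_biotSavart_le_of_impulse_eq_zero`. The generic case
(no moment condition beyond `∫ω = 0`, which holds for EVERY integrable `C¹` divergence-free field,
tree `integral_eq_zero_of_isDivFree_of_integrable`) is the third-order bound
`(1 + ‖x‖)³ ‖biotSavart ω x‖ ≤ K (C₀ + ‖ω‖₁ + ∫‖y‖‖ω‖ + C₄)`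
(`exists_forall_one_add_norm_pow_three_mul_norm_biotSavart_le(_of_isDivFree)`; Saffman §3.2: «the
velocity field at infinity is `O(|I|/r³)`»).

Cell `ns-blowup` label: LABEL Literature port; bears_on LADDER-NS N1 (crux 19249 negative lane —
the «zero impulse ⇒ O(|x|⁻⁴) tails ⇒ slice ∈ L¹» input of `CapStratumIntegrable`; with the tree's
`IsTaoSolutionOn.biotSavart_curl_eq_self` every Tao-class slice is the Biot–Savart velocity of its
vorticity). WHAT THIS IS NOT: not NS — an estimate for a fixed kernel against a fixed density; the
persistence in time of the vorticity decay (Lemarié-Rieusset Thm. 4.12) is NOT here.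

## Mathlib / tree search

Tree (all used): `biotSavart`, `biotSavartKernel`, `cross` (`Vorticity`, `VectorCalculus`);
`integrable_biotSavartKernel_sub_apply` (`BiotSavartIntegral`); `fderiv_newtonKernel_apply`
(`NewtonKernel`); `exists_forall_one_add_norm_pow_four_mul_abs_integral_le`,
`integrable_fderiv_newtonKernel_sub_mul` (`NewtonPotentialGradientFarField`);
`PineauVicol2026.integral_divergence_eq_zero_of_integrable_div` (`PineauVicolEnstrophy`),
`divergence_smul_apply` (`WholeSpaceIBP`), `crossCLM` (`VectorCalculus`) — the pattern of
`HydrodynamicImpulse.integral_inner_eq_zero_of_isDivFree_of_integrable`. `lean search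
'biotSavart.*moment|impulse.*biotSavart|farField'`: no far-field bound of the Biot–Savart velocity
existed (the tree's `BiotSavartBounds` / `AxisymBiotSavartSupBound` are sup bounds). Mathlib:
`PiLp.norm_apply_le`, `EuclideanSpace.proj`, `ContinuousLinearMap.integral_comp_comm`,
`EuclideanSpace.inner_single_right`, `cross_apply`.

## References

* P. G. Lemarié-Rieusset, *The Navier–Stokes Problem in the 21st Century*, CRC Press 2016, §4.10,
  eqs. (4.37)–(4.38) (p. 63). [LemarieRieusset2016]
* A. J. Majda, A. L. Bertozzi, *Vorticity and Incompressible Flow* (CUP 2002), §2.4.1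
  (2.92)–(2.94). [MajdaBertozziCUP2002]
* P. G. Saffman, *Vortex Dynamics* (CUP 1992), §3.2 (3.2.8) (hydrodynamic impulse). [Saffman1992]
-/

noncomputable section

open MeasureTheory Set Filter Metric Topology Function Real
open scoped RealInnerProductSpace

namespace Literature.Analysis.FluidPDE

/-! ### Components of the Biot–Savart kernel through the gradient of the Newtonian kernel -/

section Kernel

/-- `(K(z)h)₀ = ∂₂Γ(z) h₁ − ∂₁Γ(z) h₂` for `z ≠ 0` (`∂ⱼΓ(z) = zⱼ/(4π|z|³)`, `(h × z)₀ = h₁z₂ − h₂z₁`).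
[cite: MajdaBertozziCUP2002, §2.4.1 (2.92)–(2.94)] -/
theorem biotSavartKernel_apply_zero {z : EuclideanSpace ℝ (Fin 3)} (hz : z ≠ 0) (h : EuclideanSpace ℝ (Fin 3)) :
    biotSavartKernel z h 0 = fderiv ℝ newtonKernel z (EuclideanSpace.single 2 (1 : ℝ)) * h 1 -
      fderiv ℝ newtonKernel z (EuclideanSpace.single 1 (1 : ℝ)) * h 2 := by
  rw [fderiv_newtonKernel_apply hz, fderiv_newtonKernel_apply hz, EuclideanSpace.inner_single_right,
    EuclideanSpace.inner_single_right]
  simp [biotSavartKernel, cross, cross_apply]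
  ring

/-- `(K(z)h)₁ = ∂₀Γ(z) h₂ − ∂₂Γ(z) h₀` for `z ≠ 0`. [cite: MajdaBertozziCUP2002, §2.4.1 (2.92)–(2.94)] -/
theorem biotSavartKernel_apply_one {z : EuclideanSpace ℝ (Fin 3)} (hz : z ≠ 0) (h : EuclideanSpace ℝ (Fin 3)) :
    biotSavartKernel z h 1 = fderiv ℝ newtonKernel z (EuclideanSpace.single 0 (1 : ℝ)) * h 2 -
      fderiv ℝ newtonKernel z (EuclideanSpace.single 2 (1 : ℝ)) * h 0 := by
  rw [fderiv_newtonKernel_apply hz, fderiv_newtonKernel_apply hz, EuclideanSpace.inner_single_right,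
    EuclideanSpace.inner_single_right]
  simp [biotSavartKernel, cross, cross_apply]
  ring

/-- `(K(z)h)₂ = ∂₁Γ(z) h₀ − ∂₀Γ(z) h₁` for `z ≠ 0`. [cite: MajdaBertozziCUP2002, §2.4.1 (2.92)–(2.94)] -/
theorem biotSavartKernel_apply_two {z : EuclideanSpace ℝ (Fin 3)} (hz : z ≠ 0) (h : EuclideanSpace ℝ (Fin 3)) :
    biotSavartKernel z h 2 = fderiv ℝ newtonKernel z (EuclideanSpace.single 1 (1 : ℝ)) * h 0 -
      fderiv ℝ newtonKernel z (EuclideanSpace.single 0 (1 : ℝ)) * h 1 := by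
  rw [fderiv_newtonKernel_apply hz, fderiv_newtonKernel_apply hz, EuclideanSpace.inner_single_right,
    EuclideanSpace.inner_single_right]
  simp [biotSavartKernel, cross, cross_apply]
  ring

end Kernel

/-! ### The far-field bound -/

section FarField

/-- `ℓ² ≤ ℓ¹` on `ℝ³`: `‖v‖ ≤ |v₀| + |v₁| + |v₂|`. [folklore] -/
private theorem norm_le_sum_abs_coord_fin3 (v : EuclideanSpace ℝ (Fin 3)) : ‖v‖ ≤ |v 0| + |v 1| + |v 2| := by
  have h : v = ∑ l, v l • EuclideanSpace.single l (1 : ℝ) := by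
    have := (EuclideanSpace.basisFun (Fin 3) ℝ).sum_repr v
    simp only [EuclideanSpace.basisFun_repr, EuclideanSpace.basisFun_apply] at this
    exact this.symm
  calc ‖v‖ = ‖∑ l, v l • EuclideanSpace.single l (1 : ℝ)‖ := by rw [← h]
    _ ≤ ∑ l, ‖v l • EuclideanSpace.single l (1 : ℝ)‖ := norm_sum_le _ _
    _ = ∑ l, |v l| := by
        refine Finset.sum_congr rfl fun l _ => ?_
        rw [norm_smul, Real.norm_eq_abs]
        simp [PiLp.norm_single]
    _ = |v 0| + |v 1| + |v 2| := by
        simp [Fin.sum_univ_succ]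
        ring

/-- **A component of the Biot–Savart velocity is a difference of two gradient potentials of the
components of the vorticity**: if `(K(z)h)ₖ = ∂_{i₁}Γ(z) h_{j₁} − ∂_{i₂}Γ(z) h_{j₂}` off the origin,
then for `ω ∈ L¹ ∩ L^∞` measurable,
`(biotSavart ω x)ₖ = ∫ ∂_{i₁}Γ(x − y) ω_{j₁}(y) dy − ∫ ∂_{i₂}Γ(x − y) ω_{j₂}(y) dy`.
[cite: MajdaBertozziCUP2002, §2.4.1 (2.92)–(2.94)] -/
theorem biotSavart_apply_eq_sub_of_kernel {ω : EuclideanSpace ℝ (Fin 3) → EuclideanSpace ℝ (Fin 3)}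
    (hωm : Measurable ω) (hωi : Integrable ω volume) {C₀ : ℝ} (hωb : ∀ y, ‖ω y‖ ≤ C₀)
    {k i₁ j₁ i₂ j₂ : Fin 3}
    (hK : ∀ z : EuclideanSpace ℝ (Fin 3), z ≠ 0 → ∀ h : EuclideanSpace ℝ (Fin 3),
      biotSavartKernel z h k = fderiv ℝ newtonKernel z (EuclideanSpace.single i₁ (1 : ℝ)) * h j₁ -
        fderiv ℝ newtonKernel z (EuclideanSpace.single i₂ (1 : ℝ)) * h j₂)
    (x : EuclideanSpace ℝ (Fin 3)) :
    biotSavart ω x k = (∫ y, fderiv ℝ newtonKernel (x - y) (EuclideanSpace.single i₁ (1 : ℝ)) * ω y j₁) -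
      ∫ y, fderiv ℝ newtonKernel (x - y) (EuclideanSpace.single i₂ (1 : ℝ)) * ω y j₂ := by
  have hint := integrable_biotSavartKernel_sub_apply hωm hωi hωb x
  -- the components of `ω` are bounded integrable functions
  have hcomp : ∀ j : Fin 3, Integrable (fun y ↦ ω y j) volume ∧ ∀ y ∈ ball x 1, |ω y j| ≤ C₀ := fun j ↦
    ⟨by simpa only [EuclideanSpace.coe_proj] using
      (EuclideanSpace.proj j : EuclideanSpace ℝ (Fin 3) →L[ℝ] ℝ).integrable_comp hωi, fun y _ ↦
      (Real.norm_eq_abs _ ▸ PiLp.norm_apply_le (ω y) j).trans (hωb y)⟩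
  have h1 := (integrable_fderiv_newtonKernel_sub_mul (hcomp j₁).1 (hcomp j₁).2
    (EuclideanSpace.single i₁ (1 : ℝ))).1
  have h2 := (integrable_fderiv_newtonKernel_sub_mul (hcomp j₂).1 (hcomp j₂).2
    (EuclideanSpace.single i₂ (1 : ℝ))).1
  -- the `k`-th component commutes with the Bochner integral
  have hproj : biotSavart ω x k = ∫ y, biotSavartKernel (x - y) (ω y) k := by
    have h := ((EuclideanSpace.proj k : EuclideanSpace ℝ (Fin 3) →L[ℝ] ℝ).integral_comp_comm hint).symm
    simpa only [biotSavart, EuclideanSpace.coe_proj] using h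
  rw [hproj, ← integral_sub h1 h2]
  refine integral_congr_ae ?_
  have hx : ∀ᵐ y ∂(volume : Measure (EuclideanSpace ℝ (Fin 3))), y ≠ x := by
    rw [ae_iff]
    simp only [ne_eq, not_not, setOf_eq_eq_singleton, measure_singleton]
  filter_upwards [hx] with y hy
  exact hK (x - y) (sub_ne_zero.2 (Ne.symm hy)) (ω y)

/-- **Far field of the Biot–Savart velocity of a vorticity with vanishing moments.** There is an
absolute constant `K > 0` such that for every measurable `ω : ℝ³ → ℝ³` with `ω ∈ L¹`,
`∫ ‖y‖² ‖ω(y)‖ dy < ∞`, `‖ω‖ ≤ C₀`, `‖y‖⁵ ‖ω(y)‖ ≤ C₅`, zero total vorticity `∫ ω = 0` and vanishing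
first moments `∫ ωⱼ(y) y dy = 0` (`j = 0, 1, 2`), the Biot–Savart velocity satisfies, for ALL `x`,

  `(1 + ‖x‖)⁴ ‖biotSavart ω x‖ ≤ K (C₀ + ‖ω‖₁ + ∫‖y‖²‖ω‖ + C₅)`.

This is the bound form of Lemarié-Rieusset's (4.37)–(4.38): with `A = ∫ω = 0` and `Bᵢ = −∫yᵢω = 0`
the expansion starts at the quadrupole term `∇∂ᵢ∂ⱼG ∧ Cᵢⱼ = O(|x|⁻⁴)` («zero impulse ⇒ `|x|⁻⁴`
tails»; in particular `u ∈ L¹(ℝ³)`). Each component of `u` is a difference of two gradient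
potentials of components of `ω` (`biotSavart_apply_eq_sub_of_kernel`), each bounded by
`exists_forall_one_add_norm_pow_four_mul_abs_integral_le`; `K = 6 K₁`.
[cite: LemarieRieusset2016, §4.10 eqs. (4.37)–(4.38) (p. 63)] -/
theorem exists_forall_one_add_norm_pow_four_mul_norm_biotSavart_le :
    ∃ K : ℝ, 0 < K ∧ ∀ {ω : EuclideanSpace ℝ (Fin 3) → EuclideanSpace ℝ (Fin 3)}, Measurable ω →
      Integrable ω volume → Integrable (fun y ↦ ‖y‖ ^ 2 * ‖ω y‖) volume →
      ∀ {C₀ : ℝ}, (∀ y, ‖ω y‖ ≤ C₀) → ∀ {C₅ : ℝ}, (∀ y, ‖y‖ ^ 5 * ‖ω y‖ ≤ C₅) →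
      (∫ y, ω y) = 0 → (∀ j : Fin 3, (∫ y, ω y j • y) = (0 : EuclideanSpace ℝ (Fin 3))) →
      ∀ x : EuclideanSpace ℝ (Fin 3),
        (1 + ‖x‖) ^ 4 * ‖biotSavart ω x‖ ≤
          K * (C₀ + (∫ y, ‖ω y‖) + (∫ y, ‖y‖ ^ 2 * ‖ω y‖) + C₅) := by
  obtain ⟨K₁, hK₁, hV⟩ := exists_forall_one_add_norm_pow_four_mul_abs_integral_le
  refine ⟨6 * K₁, by positivity, fun {ω} hωm hωi hM2 {C₀} hC₀ {C₅} hC₅ h0 h1 x ↦ ?_⟩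
  set S : ℝ := C₀ + (∫ y, ‖ω y‖) + (∫ y, ‖y‖ ^ 2 * ‖ω y‖) + C₅ with hS
  -- componentwise data
  have hωj_int : ∀ j : Fin 3, Integrable (fun y ↦ ω y j) volume := fun j ↦ by
    simpa only [EuclideanSpace.coe_proj] using
      (EuclideanSpace.proj j : EuclideanSpace ℝ (Fin 3) →L[ℝ] ℝ).integrable_comp hωi
  have hωj_abs : ∀ j : Fin 3, ∀ y, |ω y j| ≤ ‖ω y‖ := fun j y ↦
    Real.norm_eq_abs _ ▸ PiLp.norm_apply_le (ω y) j
  have hωj_M2 : ∀ j : Fin 3, Integrable (fun y ↦ ‖y‖ ^ 2 * ω y j) volume := by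
    intro j
    refine hM2.mono' ((continuous_norm.measurable.pow_const 2).aestronglyMeasurable.mul (hωj_int j).1)
      (Eventually.of_forall fun y ↦ ?_)
    rw [norm_mul, Real.norm_eq_abs, Real.norm_eq_abs, abs_pow, abs_norm]
    exact mul_le_mul_of_nonneg_left (hωj_abs j y) (by positivity)
  have hωj_C₀ : ∀ j : Fin 3, ∀ y, |ω y j| ≤ C₀ := fun j y ↦ (hωj_abs j y).trans (hC₀ y)
  have hωj_C₅ : ∀ j : Fin 3, ∀ y, ‖y‖ ^ 5 * |ω y j| ≤ C₅ := fun j y ↦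
    (mul_le_mul_of_nonneg_left (hωj_abs j y) (by positivity)).trans (hC₅ y)
  have hωj_0 : ∀ j : Fin 3, (∫ y, ω y j) = 0 := by
    intro j
    have h := ((EuclideanSpace.proj j : EuclideanSpace ℝ (Fin 3) →L[ℝ] ℝ).integral_comp_comm hωi)
    simp only [EuclideanSpace.coe_proj] at h
    rw [h, h0]
    rfl
  -- the componentwise sums are dominated by `S`
  have hL1 : ∀ j : Fin 3, (∫ y, |ω y j|) ≤ ∫ y, ‖ω y‖ := fun j ↦
    integral_mono (hωj_int j).abs hωi.norm (fun y ↦ hωj_abs j y)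
  have hI2 : ∀ j : Fin 3, (∫ y, ‖y‖ ^ 2 * |ω y j|) ≤ ∫ y, ‖y‖ ^ 2 * ‖ω y‖ := by
    intro j
    refine integral_mono ?_ hM2 (fun y ↦ mul_le_mul_of_nonneg_left (hωj_abs j y) (by positivity))
    refine (hωj_M2 j).abs.congr (Eventually.of_forall fun y ↦ ?_)
    simp only [abs_mul, abs_pow, abs_norm]
  -- each gradient potential of a component is `O((1 + |x|)⁻⁴)`
  have hcomp : ∀ i j : Fin 3,
      (1 + ‖x‖) ^ 4 * |∫ y, fderiv ℝ newtonKernel (x - y) (EuclideanSpace.single i (1 : ℝ)) * ω y j| ≤ K₁ * S := by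
    intro i j
    have h := hV (hωj_int j) (hωj_M2 j) (hωj_C₀ j) (hωj_C₅ j) (hωj_0 j) (h1 j) x (EuclideanSpace.single i (1 : ℝ))
    have he : ‖(EuclideanSpace.single i (1 : ℝ) : EuclideanSpace ℝ (Fin 3))‖ = 1 := by
      rw [PiLp.norm_single (2 : ENNReal) (fun _ : Fin 3 => ℝ) i (1 : ℝ), norm_one]
    rw [he, mul_one] at h
    refine h.trans (mul_le_mul_of_nonneg_left ?_ hK₁.le)
    rw [hS]
    linarith [hL1 j, hI2 j]
  -- the three components of `u`
  have hu0 := biotSavart_apply_eq_sub_of_kernel hωm hωi hC₀ (k := 0) (i₁ := 2) (j₁ := 1) (i₂ := 1) (j₂ := 2)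
    (fun z hz h ↦ biotSavartKernel_apply_zero hz h) x
  have hu1 := biotSavart_apply_eq_sub_of_kernel hωm hωi hC₀ (k := 1) (i₁ := 0) (j₁ := 2) (i₂ := 2) (j₂ := 0)
    (fun z hz h ↦ biotSavartKernel_apply_one hz h) x
  have hu2 := biotSavart_apply_eq_sub_of_kernel hωm hωi hC₀ (k := 2) (i₁ := 1) (j₁ := 0) (i₂ := 0) (j₂ := 1)
    (fun z hz h ↦ biotSavartKernel_apply_two hz h) x
  have hw0 : 0 ≤ (1 + ‖x‖) ^ 4 := by positivity
  have hbd : ∀ {k i₁ j₁ i₂ j₂ : Fin 3},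
      biotSavart ω x k = (∫ y, fderiv ℝ newtonKernel (x - y) (EuclideanSpace.single i₁ (1 : ℝ)) * ω y j₁) -
        ∫ y, fderiv ℝ newtonKernel (x - y) (EuclideanSpace.single i₂ (1 : ℝ)) * ω y j₂ →
      (1 + ‖x‖) ^ 4 * |biotSavart ω x k| ≤ 2 * (K₁ * S) := by
    intro k i₁ j₁ i₂ j₂ hk
    rw [hk]
    calc (1 + ‖x‖) ^ 4 * |(∫ y, fderiv ℝ newtonKernel (x - y) (EuclideanSpace.single i₁ (1 : ℝ)) * ω y j₁) -
          ∫ y, fderiv ℝ newtonKernel (x - y) (EuclideanSpace.single i₂ (1 : ℝ)) * ω y j₂|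
        ≤ (1 + ‖x‖) ^ 4 * (|∫ y, fderiv ℝ newtonKernel (x - y) (EuclideanSpace.single i₁ (1 : ℝ)) * ω y j₁| +
            |∫ y, fderiv ℝ newtonKernel (x - y) (EuclideanSpace.single i₂ (1 : ℝ)) * ω y j₂|) :=
          mul_le_mul_of_nonneg_left (abs_sub _ _) hw0
      _ ≤ K₁ * S + K₁ * S := by rw [mul_add]; exact add_le_add (hcomp i₁ j₁) (hcomp i₂ j₂)
      _ = 2 * (K₁ * S) := by ring
  calc (1 + ‖x‖) ^ 4 * ‖biotSavart ω x‖
      ≤ (1 + ‖x‖) ^ 4 * (|biotSavart ω x 0| + |biotSavart ω x 1| + |biotSavart ω x 2|) :=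
        mul_le_mul_of_nonneg_left (norm_le_sum_abs_coord_fin3 _) hw0
    _ = (1 + ‖x‖) ^ 4 * |biotSavart ω x 0| + (1 + ‖x‖) ^ 4 * |biotSavart ω x 1| +
          (1 + ‖x‖) ^ 4 * |biotSavart ω x 2| := by ring
    _ ≤ 2 * (K₁ * S) + 2 * (K₁ * S) + 2 * (K₁ * S) := add_le_add (add_le_add (hbd hu0) (hbd hu1)) (hbd hu2)
    _ = 6 * K₁ * S := by ring

end FarField

/-! ### Zero hydrodynamic impulse: the first moments of a divergence-free vorticity -/

section Impulse

variable {ω : EuclideanSpace ℝ (Fin 3) → EuclideanSpace ℝ (Fin 3)}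

/-- `‖a × b‖ ≤ ‖a‖ ‖b‖` (private copy of `norm_cross_le` of `PoincareHomotopyOperatorL2.lean`). [folklore] -/
private theorem norm_cross_le'' (a b : EuclideanSpace ℝ (Fin 3)) : ‖cross a b‖ ≤ ‖a‖ * ‖b‖ := by
  rw [norm_cross]
  have h1 : Real.sin (InnerProductGeometry.angle a b) ≤ 1 := Real.sin_le_one _
  have h0 : 0 ≤ ‖a‖ * ‖b‖ := by positivity
  nlinarith

/-- A coordinate moment `y ↦ yᵢ ωⱼ(y)` is integrable when `∫ ‖y‖ ‖ω‖ < ∞` (`ω` continuous). [folklore] -/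
private theorem integrable_coord_mul_apply (hωc : Continuous ω)
    (hM1 : Integrable (fun y ↦ ‖y‖ * ‖ω y‖) volume) (i j : Fin 3) :
    Integrable (fun y : EuclideanSpace ℝ (Fin 3) ↦ y i * ω y j) volume := by
  have hci : Continuous fun y : EuclideanSpace ℝ (Fin 3) ↦ y i :=
    (EuclideanSpace.proj i : EuclideanSpace ℝ (Fin 3) →L[ℝ] ℝ).continuous
  have hcj : Continuous fun y : EuclideanSpace ℝ (Fin 3) ↦ ω y j :=
    (EuclideanSpace.proj j : EuclideanSpace ℝ (Fin 3) →L[ℝ] ℝ).continuous.comp hωc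
  refine hM1.mono' (hci.mul hcj).aestronglyMeasurable (Eventually.of_forall fun y ↦ ?_)
  rw [norm_mul, Real.norm_eq_abs, Real.norm_eq_abs]
  exact mul_le_mul (Real.norm_eq_abs _ ▸ PiLp.norm_apply_le y i)
    (Real.norm_eq_abs _ ▸ PiLp.norm_apply_le (ω y) j) (abs_nonneg _) (norm_nonneg _)

/-- **The moment matrix of a divergence-free vorticity is antisymmetric** (Saffman 1992, §3.2: the
step behind (3.2.11) `∫ u = ⅔ I`-type identities): for a `C¹` divergence-free field `ω` on `ℝ³` with
`∫ ‖y‖ ‖ω(y)‖ dy < ∞` and all `i, j`, `∫ (yᵢ ωⱼ(y) + yⱼ ωᵢ(y)) dy = 0` — the divergence theorem for the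
field `(yᵢ yⱼ) ω`, whose divergence is `yⱼ ωᵢ + yᵢ ωⱼ` and whose size is `≤ ‖y‖² ‖ω‖`
(`PineauVicol2026.integral_divergence_eq_zero_of_integrable_div`). [cite: Saffman1992, §3.2 eqs. (3.2.8)–(3.2.11)] -/
theorem integral_coord_mul_apply_add_eq_zero (hω : ContDiff ℝ 1 ω) (hdiv : VectorCalculus.IsDivFree ω)
    (hM1 : Integrable (fun y ↦ ‖y‖ * ‖ω y‖) volume) (i j : Fin 3) :
    ∫ y : EuclideanSpace ℝ (Fin 3), (y i * ω y j + y j * ω y i) = 0 := by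
  -- the weight `θ y = yᵢ yⱼ` and the field `F = θ • ω`
  set θ : EuclideanSpace ℝ (Fin 3) → ℝ := fun y ↦ y i * y j with hθ
  have hπ : ∀ (k : Fin 3) (y : EuclideanSpace ℝ (Fin 3)),
      HasFDerivAt (fun y : EuclideanSpace ℝ (Fin 3) ↦ y k) (EuclideanSpace.proj k : EuclideanSpace ℝ (Fin 3) →L[ℝ] ℝ) y :=
    fun k y ↦ (EuclideanSpace.proj k : EuclideanSpace ℝ (Fin 3) →L[ℝ] ℝ).hasFDerivAt
  have hθ' : ∀ y, HasFDerivAt θ (y i • (EuclideanSpace.proj j : EuclideanSpace ℝ (Fin 3) →L[ℝ] ℝ) +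
      y j • (EuclideanSpace.proj i : EuclideanSpace ℝ (Fin 3) →L[ℝ] ℝ)) y := by
    intro y
    have h := (hπ i y).mul (hπ j y)
    exact h
  have hθd : ContDiff ℝ 1 θ :=
    (EuclideanSpace.proj i : EuclideanSpace ℝ (Fin 3) →L[ℝ] ℝ).contDiff.mul
      (EuclideanSpace.proj j : EuclideanSpace ℝ (Fin 3) →L[ℝ] ℝ).contDiff
  set F : EuclideanSpace ℝ (Fin 3) → EuclideanSpace ℝ (Fin 3) := fun y ↦ θ y • ω y with hF
  have hF1 : ContDiff ℝ 1 F := hθd.smul hω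
  -- its divergence
  have hdivF : ∀ y, VectorCalculus.divergence F y = y i * ω y j + y j * ω y i := by
    intro y
    have hωy : DifferentiableAt ℝ ω y := (hω.differentiable one_ne_zero) y
    rw [hF, divergence_smul_apply (hθ' y).differentiableAt hωy, hdiv y, mul_zero, zero_add,
      real_inner_comm, gradient, InnerProductSpace.toDual_symm_apply, (hθ' y).fderiv]
    simp
  have hdivF' : (fun y ↦ VectorCalculus.divergence F y) = fun y ↦ y i * ω y j + y j * ω y i := funext hdivF
  -- integrability of `div F` and of `‖F‖/(1 + ‖y‖)`
  have hdI : Integrable (fun y ↦ VectorCalculus.divergence F y) volume := by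
    rw [hdivF']
    exact (integrable_coord_mul_apply hω.continuous hM1 i j).add (integrable_coord_mul_apply hω.continuous hM1 j i)
  have hwI : Integrable (fun y ↦ ‖F y‖ / (1 + ‖y‖)) volume := by
    refine hM1.mono' ?_ (Eventually.of_forall fun y ↦ ?_)
    · exact ((hF1.continuous.norm).div (continuous_const.add continuous_norm)
        fun y ↦ (by positivity : (1 : ℝ) + ‖y‖ ≠ 0)).aestronglyMeasurable
    · have h1 : 0 < 1 + ‖y‖ := by positivity
      rw [Real.norm_of_nonneg (by positivity), hF, norm_smul, div_le_iff₀ h1, hθ]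
      have hi := Real.norm_eq_abs _ ▸ PiLp.norm_apply_le y i
      have hj := Real.norm_eq_abs _ ▸ PiLp.norm_apply_le y j
      rw [Real.norm_eq_abs, abs_mul]
      calc |y i| * |y j| * ‖ω y‖ ≤ ‖y‖ * ‖y‖ * ‖ω y‖ := by gcongr
        _ ≤ ‖y‖ * ‖ω y‖ * (1 + ‖y‖) := by nlinarith [norm_nonneg y, norm_nonneg (ω y)]
  have h := PineauVicol2026.integral_divergence_eq_zero_of_integrable_div hF1 hwI hdI
  rwa [hdivF'] at h

/-- **Zero hydrodynamic impulse forces all first moments of a divergence-free vorticity to vanish.**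
For a `C¹` divergence-free `ω` on `ℝ³` with `∫‖y‖‖ω‖ < ∞`, if the impulse `∫ y × ω(y) dy`
(Saffman (3.2.8): `I = ½∫ x × ω`) vanishes then `∫ ωⱼ(y) y dy = 0` for each `j`: the moment matrix
`Mᵢⱼ = ∫ yᵢ ωⱼ` is antisymmetric (`integral_coord_mul_apply_add_eq_zero`) and its three independent
entries are the components of `I`. [cite: Saffman1992, §3.2 eq. (3.2.8)] -/
theorem integral_apply_smul_self_eq_zero_of_impulse_eq_zero (hω : ContDiff ℝ 1 ω)
    (hdiv : VectorCalculus.IsDivFree ω) (hM1 : Integrable (fun y ↦ ‖y‖ * ‖ω y‖) volume)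
    (hI : (∫ y, cross y (ω y)) = 0) (j : Fin 3) :
    (∫ y, ω y j • y) = (0 : EuclideanSpace ℝ (Fin 3)) := by
  have hint := integrable_coord_mul_apply hω.continuous hM1
  -- antisymmetry of the moment matrix
  have hanti : ∀ i j : Fin 3, (∫ y : EuclideanSpace ℝ (Fin 3), y i * ω y j) = -∫ y : EuclideanSpace ℝ (Fin 3), y j * ω y i := by
    intro i j
    have h := integral_coord_mul_apply_add_eq_zero hω hdiv hM1 i j
    rw [integral_add (hint i j) (hint j i)] at h
    linarith
  have hdiag : ∀ i : Fin 3, (∫ y : EuclideanSpace ℝ (Fin 3), y i * ω y i) = 0 := fun i ↦ by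
    have h := hanti i i
    linarith
  -- the impulse components
  have hcross : Integrable (fun y ↦ cross y (ω y)) volume := by
    refine hM1.mono' ?_ (Eventually.of_forall fun y ↦ norm_cross_le'' y (ω y))
    have hc : Continuous fun y ↦ cross y (ω y) := by
      have h : Continuous fun y ↦ crossCLM y (ω y) := crossCLM.continuous.clm_apply hω.continuous
      simpa only [crossCLM_apply] using h
    exact hc.aestronglyMeasurable
  have hIk : ∀ k : Fin 3, (∫ y, cross y (ω y) k) = 0 := by
    intro k
    have h := ((EuclideanSpace.proj k : EuclideanSpace ℝ (Fin 3) →L[ℝ] ℝ).integral_comp_comm hcross)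
    simp only [EuclideanSpace.coe_proj] at h
    rw [h, hI]
    rfl
  have hc0 : ∀ y : EuclideanSpace ℝ (Fin 3), cross y (ω y) 0 = y 1 * ω y 2 - y 2 * ω y 1 := fun y ↦ by
    simp [cross, cross_apply]
  have hc1 : ∀ y : EuclideanSpace ℝ (Fin 3), cross y (ω y) 1 = y 2 * ω y 0 - y 0 * ω y 2 := fun y ↦ by
    simp [cross, cross_apply]
  have hc2 : ∀ y : EuclideanSpace ℝ (Fin 3), cross y (ω y) 2 = y 0 * ω y 1 - y 1 * ω y 0 := fun y ↦ by
    simp [cross, cross_apply]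
  have hM12 : (∫ y : EuclideanSpace ℝ (Fin 3), y 1 * ω y 2) = 0 := by
    have h := hIk 0
    simp_rw [hc0] at h
    rw [integral_sub (hint 1 2) (hint 2 1), hanti 2 1] at h
    linarith
  have hM20 : (∫ y : EuclideanSpace ℝ (Fin 3), y 2 * ω y 0) = 0 := by
    have h := hIk 1
    simp_rw [hc1] at h
    rw [integral_sub (hint 2 0) (hint 0 2), hanti 0 2] at h
    linarith
  have hM01 : (∫ y : EuclideanSpace ℝ (Fin 3), y 0 * ω y 1) = 0 := by
    have h := hIk 2
    simp_rw [hc2] at h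
    rw [integral_sub (hint 0 1) (hint 1 0), hanti 1 0] at h
    linarith
  have hM : ∀ i j : Fin 3, (∫ y : EuclideanSpace ℝ (Fin 3), y i * ω y j) = 0 := by
    have hM21 : (∫ y : EuclideanSpace ℝ (Fin 3), y 2 * ω y 1) = 0 := by rw [hanti 2 1, hM12, neg_zero]
    have hM02 : (∫ y : EuclideanSpace ℝ (Fin 3), y 0 * ω y 2) = 0 := by rw [hanti 0 2, hM20, neg_zero]
    have hM10 : (∫ y : EuclideanSpace ℝ (Fin 3), y 1 * ω y 0) = 0 := by rw [hanti 1 0, hM01, neg_zero]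
    intro i j
    fin_cases i <;> fin_cases j
    · exact hdiag 0
    · exact hM01
    · exact hM02
    · exact hM10
    · exact hdiag 1
    · exact hM12
    · exact hM20
    · exact hM21
    · exact hdiag 2
  -- assemble the vector moment
  have hvint : Integrable (fun y ↦ ω y j • y) volume := by
    refine hM1.mono' ?_ (Eventually.of_forall fun y ↦ ?_)
    · exact (((EuclideanSpace.proj j : EuclideanSpace ℝ (Fin 3) →L[ℝ] ℝ).continuous.comp hω.continuous).smul
        continuous_id).aestronglyMeasurable
    · rw [norm_smul, mul_comm]
      exact mul_le_mul_of_nonneg_left (Real.norm_eq_abs _ ▸ PiLp.norm_apply_le (ω y) j) (norm_nonneg _)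
  ext i
  have h := ((EuclideanSpace.proj i : EuclideanSpace ℝ (Fin 3) →L[ℝ] ℝ).integral_comp_comm hvint)
  simp only [EuclideanSpace.coe_proj, PiLp.smul_apply, smul_eq_mul] at h
  rw [show (∫ y, ω y j • y) i = ∫ y, ω y j * y i from h.symm]
  have e : (fun y : EuclideanSpace ℝ (Fin 3) ↦ ω y j * y i) = fun y ↦ y i * ω y j := funext fun y ↦ mul_comm _ _
  rw [e, hM i j]
  rfl

/-- **Far field of the Biot–Savart velocity, impulse form.** There is an absolute constant `K > 0`
such that for every `C¹` divergence-free vorticity `ω` on `ℝ³` with `ω ∈ L¹`, `∫‖y‖‖ω‖ < ∞`,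
`∫‖y‖²‖ω‖ < ∞`, `‖ω‖ ≤ C₀`, `‖y‖⁵‖ω(y)‖ ≤ C₅`, zero total vorticity `∫ ω = 0` and ZERO HYDRODYNAMIC
IMPULSE `∫ y × ω(y) dy = 0`, for all `x`:
`(1 + ‖x‖)⁴ ‖biotSavart ω x‖ ≤ K (C₀ + ‖ω‖₁ + ∫‖y‖²‖ω‖ + C₅)` — Lemarié-Rieusset (4.37)–(4.38) with
`A = 0`, `Bᵢ = 0`; Saffman §3.2: «the velocity field at infinity is `O(|I|/r³)`».
[cite: LemarieRieusset2016, §4.10 eqs. (4.37)–(4.38) (p. 63)] [cite: Saffman1992, §3.2 eq. (3.2.8)] -/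
theorem exists_forall_one_add_norm_pow_four_mul_norm_biotSavart_le_of_impulse_eq_zero :
    ∃ K : ℝ, 0 < K ∧ ∀ {ω : EuclideanSpace ℝ (Fin 3) → EuclideanSpace ℝ (Fin 3)}, ContDiff ℝ 1 ω →
      VectorCalculus.IsDivFree ω → Integrable ω volume → Integrable (fun y ↦ ‖y‖ * ‖ω y‖) volume →
      Integrable (fun y ↦ ‖y‖ ^ 2 * ‖ω y‖) volume →
      ∀ {C₀ : ℝ}, (∀ y, ‖ω y‖ ≤ C₀) → ∀ {C₅ : ℝ}, (∀ y, ‖y‖ ^ 5 * ‖ω y‖ ≤ C₅) →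
      (∫ y, ω y) = 0 → (∫ y, cross y (ω y)) = 0 →
      ∀ x : EuclideanSpace ℝ (Fin 3),
        (1 + ‖x‖) ^ 4 * ‖biotSavart ω x‖ ≤
          K * (C₀ + (∫ y, ‖ω y‖) + (∫ y, ‖y‖ ^ 2 * ‖ω y‖) + C₅) := by
  obtain ⟨K, hK, h⟩ := exists_forall_one_add_norm_pow_four_mul_norm_biotSavart_le
  refine ⟨K, hK, fun {ω} hω hdiv hωi hM1 hM2 {C₀} hC₀ {C₅} hC₅ h0 hI x ↦ ?_⟩
  exact h hω.continuous.measurable hωi hM2 hC₀ hC₅ h0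
    (integral_apply_smul_self_eq_zero_of_impulse_eq_zero hω hdiv hM1 hI) x

end Impulse

/-! ### The generic far field: every localized divergence-free vorticity induces `|u| ≲ (1 + |x|)⁻³` -/

section ThirdOrder

/-- **Far field of the Biot–Savart velocity, third order.** There is an absolute constant `K > 0`
such that for every measurable `ω : ℝ³ → ℝ³` with `ω ∈ L¹`, `∫‖y‖‖ω(y)‖ dy < ∞`, `‖ω‖ ≤ C₀`,
`‖y‖⁴‖ω(y)‖ ≤ C₄` and zero total vorticity `∫ ω = 0`, for all `x`:
`(1 + ‖x‖)³ ‖biotSavart ω x‖ ≤ K (C₀ + ‖ω‖₁ + ∫‖y‖‖ω‖ + C₄)` (Lemarié-Rieusset (4.37) with `A = 0`: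
«`u = O(|x|⁻³)`»; each component through `exists_forall_one_add_norm_pow_three_mul_abs_integral_le`).
[cite: LemarieRieusset2016, §4.10 eq. (4.37) (p. 63)] -/
theorem exists_forall_one_add_norm_pow_three_mul_norm_biotSavart_le :
    ∃ K : ℝ, 0 < K ∧ ∀ {ω : EuclideanSpace ℝ (Fin 3) → EuclideanSpace ℝ (Fin 3)}, Measurable ω →
      Integrable ω volume → Integrable (fun y ↦ ‖y‖ * ‖ω y‖) volume →
      ∀ {C₀ : ℝ}, (∀ y, ‖ω y‖ ≤ C₀) → ∀ {C₄ : ℝ}, (∀ y, ‖y‖ ^ 4 * ‖ω y‖ ≤ C₄) → (∫ y, ω y) = 0 →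
      ∀ x : EuclideanSpace ℝ (Fin 3),
        (1 + ‖x‖) ^ 3 * ‖biotSavart ω x‖ ≤
          K * (C₀ + (∫ y, ‖ω y‖) + (∫ y, ‖y‖ * ‖ω y‖) + C₄) := by
  obtain ⟨K₁, hK₁, hV⟩ := exists_forall_one_add_norm_pow_three_mul_abs_integral_le
  refine ⟨6 * K₁, by positivity, fun {ω} hωm hωi hM1 {C₀} hC₀ {C₄} hC₄ h0 x ↦ ?_⟩
  set S : ℝ := C₀ + (∫ y, ‖ω y‖) + (∫ y, ‖y‖ * ‖ω y‖) + C₄ with hS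
  -- componentwise data
  have hωj_int : ∀ j : Fin 3, Integrable (fun y ↦ ω y j) volume := fun j ↦ by
    simpa only [EuclideanSpace.coe_proj] using
      (EuclideanSpace.proj j : EuclideanSpace ℝ (Fin 3) →L[ℝ] ℝ).integrable_comp hωi
  have hωj_abs : ∀ j : Fin 3, ∀ y, |ω y j| ≤ ‖ω y‖ := fun j y ↦
    Real.norm_eq_abs _ ▸ PiLp.norm_apply_le (ω y) j
  have hωj_M1 : ∀ j : Fin 3, Integrable (fun y ↦ ‖y‖ * ω y j) volume := by
    intro j
    refine hM1.mono' (continuous_norm.measurable.aestronglyMeasurable.mul (hωj_int j).1)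
      (Eventually.of_forall fun y ↦ ?_)
    rw [norm_mul, Real.norm_eq_abs, Real.norm_eq_abs, abs_norm]
    exact mul_le_mul_of_nonneg_left (hωj_abs j y) (norm_nonneg _)
  have hωj_C₀ : ∀ j : Fin 3, ∀ y, |ω y j| ≤ C₀ := fun j y ↦ (hωj_abs j y).trans (hC₀ y)
  have hωj_C₄ : ∀ j : Fin 3, ∀ y, ‖y‖ ^ 4 * |ω y j| ≤ C₄ := fun j y ↦
    (mul_le_mul_of_nonneg_left (hωj_abs j y) (by positivity)).trans (hC₄ y)
  have hωj_0 : ∀ j : Fin 3, (∫ y, ω y j) = 0 := by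
    intro j
    have h := ((EuclideanSpace.proj j : EuclideanSpace ℝ (Fin 3) →L[ℝ] ℝ).integral_comp_comm hωi)
    simp only [EuclideanSpace.coe_proj] at h
    rw [h, h0]
    rfl
  -- the componentwise sums are dominated by `S`
  have hL1 : ∀ j : Fin 3, (∫ y, |ω y j|) ≤ ∫ y, ‖ω y‖ := fun j ↦
    integral_mono (hωj_int j).abs hωi.norm (fun y ↦ hωj_abs j y)
  have hI1 : ∀ j : Fin 3, (∫ y, ‖y‖ * |ω y j|) ≤ ∫ y, ‖y‖ * ‖ω y‖ := by
    intro j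
    refine integral_mono ?_ hM1 (fun y ↦ mul_le_mul_of_nonneg_left (hωj_abs j y) (norm_nonneg _))
    refine (hωj_M1 j).abs.congr (Eventually.of_forall fun y ↦ ?_)
    simp only [abs_mul, abs_norm]
  -- each gradient potential of a component is `O((1 + |x|)⁻³)`
  have hcomp : ∀ i j : Fin 3,
      (1 + ‖x‖) ^ 3 * |∫ y, fderiv ℝ newtonKernel (x - y) (EuclideanSpace.single i (1 : ℝ)) * ω y j| ≤ K₁ * S := by
    intro i j
    have h := hV (hωj_int j) (hωj_M1 j) (hωj_C₀ j) (hωj_C₄ j) (hωj_0 j) x (EuclideanSpace.single i (1 : ℝ))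
    have he : ‖(EuclideanSpace.single i (1 : ℝ) : EuclideanSpace ℝ (Fin 3))‖ = 1 := by
      rw [PiLp.norm_single (2 : ENNReal) (fun _ : Fin 3 => ℝ) i (1 : ℝ), norm_one]
    rw [he, mul_one] at h
    refine h.trans (mul_le_mul_of_nonneg_left ?_ hK₁.le)
    rw [hS]
    linarith [hL1 j, hI1 j]
  -- the three components of `u`
  have hu0 := biotSavart_apply_eq_sub_of_kernel hωm hωi hC₀ (k := 0) (i₁ := 2) (j₁ := 1) (i₂ := 1) (j₂ := 2)
    (fun z hz h ↦ biotSavartKernel_apply_zero hz h) x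
  have hu1 := biotSavart_apply_eq_sub_of_kernel hωm hωi hC₀ (k := 1) (i₁ := 0) (j₁ := 2) (i₂ := 2) (j₂ := 0)
    (fun z hz h ↦ biotSavartKernel_apply_one hz h) x
  have hu2 := biotSavart_apply_eq_sub_of_kernel hωm hωi hC₀ (k := 2) (i₁ := 1) (j₁ := 0) (i₂ := 0) (j₂ := 1)
    (fun z hz h ↦ biotSavartKernel_apply_two hz h) x
  have hw0 : 0 ≤ (1 + ‖x‖) ^ 3 := by positivity
  have hbd : ∀ {k i₁ j₁ i₂ j₂ : Fin 3},
      biotSavart ω x k = (∫ y, fderiv ℝ newtonKernel (x - y) (EuclideanSpace.single i₁ (1 : ℝ)) * ω y j₁) -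
        ∫ y, fderiv ℝ newtonKernel (x - y) (EuclideanSpace.single i₂ (1 : ℝ)) * ω y j₂ →
      (1 + ‖x‖) ^ 3 * |biotSavart ω x k| ≤ 2 * (K₁ * S) := by
    intro k i₁ j₁ i₂ j₂ hk
    rw [hk]
    calc (1 + ‖x‖) ^ 3 * |(∫ y, fderiv ℝ newtonKernel (x - y) (EuclideanSpace.single i₁ (1 : ℝ)) * ω y j₁) -
          ∫ y, fderiv ℝ newtonKernel (x - y) (EuclideanSpace.single i₂ (1 : ℝ)) * ω y j₂|
        ≤ (1 + ‖x‖) ^ 3 * (|∫ y, fderiv ℝ newtonKernel (x - y) (EuclideanSpace.single i₁ (1 : ℝ)) * ω y j₁| +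
            |∫ y, fderiv ℝ newtonKernel (x - y) (EuclideanSpace.single i₂ (1 : ℝ)) * ω y j₂|) :=
          mul_le_mul_of_nonneg_left (abs_sub _ _) hw0
      _ ≤ K₁ * S + K₁ * S := by rw [mul_add]; exact add_le_add (hcomp i₁ j₁) (hcomp i₂ j₂)
      _ = 2 * (K₁ * S) := by ring
  calc (1 + ‖x‖) ^ 3 * ‖biotSavart ω x‖
      ≤ (1 + ‖x‖) ^ 3 * (|biotSavart ω x 0| + |biotSavart ω x 1| + |biotSavart ω x 2|) :=
        mul_le_mul_of_nonneg_left (norm_le_sum_abs_coord_fin3 _) hw0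
    _ = (1 + ‖x‖) ^ 3 * |biotSavart ω x 0| + (1 + ‖x‖) ^ 3 * |biotSavart ω x 1| +
          (1 + ‖x‖) ^ 3 * |biotSavart ω x 2| := by ring
    _ ≤ 2 * (K₁ * S) + 2 * (K₁ * S) + 2 * (K₁ * S) := add_le_add (add_le_add (hbd hu0) (hbd hu1)) (hbd hu2)
    _ = 6 * K₁ * S := by ring

/-- **Every localized divergence-free vorticity induces a velocity `O((1 + |x|)⁻³)`.** There is an
absolute constant `K > 0` such that for every `C¹` divergence-free `ω` on `ℝ³` with `ω ∈ L¹`,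
`∫‖y‖‖ω‖ < ∞`, `‖ω‖ ≤ C₀`, `‖y‖⁴‖ω(y)‖ ≤ C₄`, and all `x`:
`(1 + ‖x‖)³ ‖biotSavart ω x‖ ≤ K (C₀ + ‖ω‖₁ + ∫‖y‖‖ω‖ + C₄)` — the total vorticity of an integrable
`C¹` divergence-free field vanishes (tree `integral_eq_zero_of_isDivFree_of_integrable`, Saffman
§3.2 footnote 4), so (4.37) starts at the dipole term `O(|I|/r³)`.
[cite: LemarieRieusset2016, §4.10 eq. (4.37) (p. 63)] [cite: Saffman1992, §3.2 eq. (3.2.8)] -/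
theorem exists_forall_one_add_norm_pow_three_mul_norm_biotSavart_le_of_isDivFree :
    ∃ K : ℝ, 0 < K ∧ ∀ {ω : EuclideanSpace ℝ (Fin 3) → EuclideanSpace ℝ (Fin 3)}, ContDiff ℝ 1 ω →
      VectorCalculus.IsDivFree ω → Integrable ω volume → Integrable (fun y ↦ ‖y‖ * ‖ω y‖) volume →
      ∀ {C₀ : ℝ}, (∀ y, ‖ω y‖ ≤ C₀) → ∀ {C₄ : ℝ}, (∀ y, ‖y‖ ^ 4 * ‖ω y‖ ≤ C₄) →
      ∀ x : EuclideanSpace ℝ (Fin 3),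
        (1 + ‖x‖) ^ 3 * ‖biotSavart ω x‖ ≤
          K * (C₀ + (∫ y, ‖ω y‖) + (∫ y, ‖y‖ * ‖ω y‖) + C₄) := by
  obtain ⟨K, hK, h⟩ := exists_forall_one_add_norm_pow_three_mul_norm_biotSavart_le
  refine ⟨K, hK, fun {ω} hω hdiv hωi hM1 {C₀} hC₀ {C₄} hC₄ x ↦ ?_⟩
  exact h hω.continuous.measurable hωi hM1 hC₀ hC₄
    (integral_eq_zero_of_isDivFree_of_integrable hω hdiv hωi) x

end ThirdOrder

/-! ### The impulse form without the redundant zero-total-vorticity hypothesis -/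

section ImpulseDivFree

/-- **Far field of the Biot–Savart velocity at zero hydrodynamic impulse — consumer form.** The
hypothesis `∫ ω = 0` of `exists_forall_one_add_norm_pow_four_mul_norm_biotSavart_le_of_impulse_eq_zero`
is redundant: it holds for every integrable `C¹` divergence-free field (the tree's
`integral_eq_zero_of_isDivFree_of_integrable`, Majda–Bertozzi / Saffman §3.2 footnote 4). Hence: there
is an absolute `K > 0` such that for every `C¹` divergence-free `ω : ℝ³ → ℝ³` with `ω ∈ L¹`,
`∫‖y‖‖ω‖ < ∞`, `∫‖y‖²‖ω‖ < ∞`, `‖ω‖ ≤ C₀`, `‖y‖⁵‖ω(y)‖ ≤ C₅` and ZERO HYDRODYNAMIC IMPULSE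
`∫ y × ω(y) dy = 0`, for all `x`: `(1 + ‖x‖)⁴ ‖biotSavart ω x‖ ≤ K (C₀ + ‖ω‖₁ + ∫‖y‖²‖ω‖ + C₅)`
(Lemarié-Rieusset (4.37)–(4.38) with `A = 0`, `Bᵢ = 0`; the shape asked for by the cell's
refuter K-read K152 (3)). [cite: LemarieRieusset2016, §4.10 eqs. (4.37)–(4.38) (p. 63)]
[cite: Saffman1992, §3.2 eq. (3.2.8)] -/
theorem exists_forall_one_add_norm_pow_four_mul_norm_biotSavart_le_of_impulse_eq_zero' :
    ∃ K : ℝ, 0 < K ∧ ∀ {ω : EuclideanSpace ℝ (Fin 3) → EuclideanSpace ℝ (Fin 3)}, ContDiff ℝ 1 ω →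
      VectorCalculus.IsDivFree ω → Integrable ω volume → Integrable (fun y ↦ ‖y‖ * ‖ω y‖) volume →
      Integrable (fun y ↦ ‖y‖ ^ 2 * ‖ω y‖) volume →
      ∀ {C₀ : ℝ}, (∀ y, ‖ω y‖ ≤ C₀) → ∀ {C₅ : ℝ}, (∀ y, ‖y‖ ^ 5 * ‖ω y‖ ≤ C₅) →
      (∫ y, cross y (ω y)) = 0 →
      ∀ x : EuclideanSpace ℝ (Fin 3),
        (1 + ‖x‖) ^ 4 * ‖biotSavart ω x‖ ≤
          K * (C₀ + (∫ y, ‖ω y‖) + (∫ y, ‖y‖ ^ 2 * ‖ω y‖) + C₅) := by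
  obtain ⟨K, hK, h⟩ := exists_forall_one_add_norm_pow_four_mul_norm_biotSavart_le_of_impulse_eq_zero
  refine ⟨K, hK, fun {ω} hω hdiv hωi hM1 hM2 {C₀} hC₀ {C₅} hC₅ hI x ↦ ?_⟩
  exact h hω hdiv hωi hM1 hM2 hC₀ hC₅ (integral_eq_zero_of_isDivFree_of_integrable hω hdiv hωi) hI x

end ImpulseDivFree

end Literature.Analysis.FluidPDE
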